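import Literature.Algebra.EuclideanLattices.RegevQuantumPart
import Literature.Algebra.EuclideanLattices.SmoothingParameterSuccMin
import HarnessLib

/-!
# Regev 2009, Lemmas 3.12/3.14: the branch states of the Gaussian register after the `mod P` measurement

Topic `Algebra/EuclideanLattices` (family `pqc`). Serves the machine form of the quantum part of
Regev's iterative step (the named fact `Literature.Computability.Cryptography.regev_lwe_to_sivp_quantum`,
pqc.S19, through hStage of `Cryptography/RegevSIVPOfStages.lean`). In the proof of Lemma 3.12 (author's
version arXiv:2401.03703, p. 19) the spherical Gaussian state over the integer grid is reduced modulo a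
basic parallelepiped of the lattice and the reduction `y` is MEASURED: "the state we obtain after the
measurement is `Σ_{x ∈ L+y} ρ_{√2r}(x)|x⟩` … we subtract `y` … `Σ_{x∈L} ρ_{√2r}(x+y)|x⟩` … this state is
within `ℓ₂` distance `2^{-Ω(n)}` of the required one"; Lemma 3.14 then reads the coset of `x` modulo `RΛ`
(register `s ∈ ℤ_Rⁿ`). In the tree's machine the grid is finite (a box of the register) and the branch
`y` is kept unmeasured (deferred measurement), so what is needed is, for EVERY `y`, the closeness of the
normalised *branch vector*

  `ψ_y(s) = Σ_{x ∈ Box, x − y ∈ x_s + RΛ} ρ(x)`   (`ρ = ρ₁`, `x_s = reprPt s`)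

on `s : ι → ZMod R` to the normalised periodic Gaussian state `ϑ₂(s) = ρ(x_s + RΛ)` (`thetaTwo`) — and
hence (`l2_normalize_thetaTwo_sub_normalize_thetaOne_le`) to `ϑ̂₁`, the input of
`Regev2009.lemma_3_14_ideal`. This file proves it, by the inner-product route (all vectors have
nonnegative entries), under the hypothesis of Lemma 3.14 that `RΛ` (`= L*` for `Λ = L*/R`) has no nonzero
vector of norm `< 2√n` (`d = √n < λ₁(L*)/2`), `‖y‖ ≤ Y`, and the one requirement on the box that it
contains `x + y` for every lattice point `x` of norm `< √n` (`BoxCoversShort`):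

* (A) `Regev2009.sum_periodicAmp_mul_branchAmp_ge`: `⟨ϑ₂, ψ_y⟩ ≥ (1 − δ)(1 − b₁ⁿ) ρ_{1/√2}(Λ)`,
  `δ = π(2√n Y + Y²)`: every short lattice point `x` of the coset `x_s + RΛ` contributes `ρ(x)` to `ϑ₂(s)`
  and `ρ(x + y) ≥ (1 − δ) ρ(x)` to `ψ_y(s)` (`gaussianFunction_add_ge`, Regev's perturbation claim), the
  cosets partition `Λ` (`sum_tsum_coset_eq_tsum`), `ρ(x)² = ρ_{1/√2}(x)`, and the long points carry at
  most `b₁ⁿ` of `ρ_{1/√2}(Λ)` (Banaszczyk, `b₁ = √2·√(2πe)·e^{-2π} ≤ 2⁻⁶`, `banaConst_le`);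
* (B) `Regev2009.sum_branchAmp_sq_le`: `‖ψ_y‖² ≤ Σ_s ψ̃_y(s)² = ρ_{(-y,-y)}(M) ≤ ρ(M) = ‖ϑ₂‖²` for Regev's
  coupling lattice `M` of Claim 3.13 (`IsTransversal.gaussianMass_couplingLattice_center_eq`, then the
  coset inequality for the discrete subgroup `M` of `V × V`, `gaussianMass_le_gaussianMass_zero_of_discrete`);
* (C) `Regev2009.gaussianMass_couplingLattice_toReal_le`: `(1 − 4⁻ⁿ) ρ(M) ≤ ρ_{1/√2}(Λ)`: the pairs of
  `M` in `√(2n) B_{2n}` are diagonal (`‖w₁ − w₂‖ ≤ √2 ‖w‖ < 2√n` forces `w₁ = w₂`), the diagonal carries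
  `Σ ρ(x)² = ρ_{1/√2}(Λ)`, and `ρ(M ∖ √(2n) B) ≤ 2^{-2n} ρ(M)` (Banaszczyk in dimension `2n`, as in the
  proof of Claim 3.13);
* (D) **`Regev2009.l2_normalize_branchVec_sub_normalize_thetaTwo_le`** and
  **`Regev2009.l2_normalize_branchVec_sub_normalize_thetaOne_le`**: the normalised branch vector is within
  `√(2(δ + b₁ⁿ + 4⁻ⁿ))` of `ϑ̂₂` and within `√(2(δ + b₁ⁿ + 4⁻ⁿ)) + 2·2⁻ⁿ` of `ϑ̂₁` (from (A)–(C):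
  `⟨ϑ₂, ψ_y⟩ ≥ κ‖ϑ₂‖²`, `‖ψ_y‖ ≤ ‖ϑ₂‖` give `‖ϑ̂₂ − ψ̂_y‖² = 2 − 2cos ≤ 2(1 − κ)`,
  `l2_normalize_sub_normalize_sq_le`; then Claim 3.13, `l2_normalize_thetaTwo_sub_normalize_thetaOne_le`).

Everything here is proved; definitions have bodies; no named fact is introduced.

## References

* O. Regev, *On lattices, learning with errors, random linear codes, and cryptography*, J. ACM 56
  (2009), art. 34; arXiv:2401.03703, Lemma 3.12 (proof, p. 19), Claim 3.13, Lemma 3.14 (proof, p. 20)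
  [Regev2009].
* W. Banaszczyk, *New bounds in some transference theorems in the geometry of numbers*, Math. Ann. 296
  (1993), Lemma 1.5 [Banaszczyk1993].
* D. Micciancio, O. Regev, *Worst-case to average-case reductions based on Gaussian measures*, SIAM J.
  Comput. 37 (2007), §2 [MicciancioRegev2007].
-/

noncomputable section

open Module Metric Complex Finset
open scoped Real InnerProductSpace ENNReal

namespace Literature.Algebra.EuclideanLattices

namespace Regev2009

open Literature.Computability.QuantumComplexity Literature.Computability.QuantumComplexity.QState

/-! ### A lemma on normalised nonnegative vectors -/

section NormalizeLemma

variable {X : Type*} [Fintype X]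

/-- For real vectors cast to `ℂ`: `‖û − v̂‖₂² = 2 − 2⟨u,v⟩/(‖u‖‖v‖)`. [folklore] -/
theorem l2_normalize_sub_normalize_sq_eq {u v : X → ℝ} (hu : (fun x => (u x : ℂ)) ≠ 0) (hv : (fun x => (v x : ℂ)) ≠ 0) :
    l2 (normalize (fun x => (u x : ℂ)) - normalize (fun x => (v x : ℂ))) ^ 2 =
      2 - 2 * (∑ x, u x * v x) / (l2 (fun x => (u x : ℂ)) * l2 (fun x => (v x : ℂ))) := by
  set a : ℝ := l2 (fun x => (u x : ℂ)) with ha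
  set b : ℝ := l2 (fun x => (v x : ℂ)) with hb
  have ha0 : 0 < a := l2_pos hu
  have hb0 : 0 < b := l2_pos hv
  have hua : ∑ x, u x ^ 2 = a ^ 2 := by
    rw [ha, l2_sq]; refine sum_congr rfl fun x _ => ?_; rw [Complex.norm_real, Real.norm_eq_abs, sq_abs]
  have hvb : ∑ x, v x ^ 2 = b ^ 2 := by
    rw [hb, l2_sq]; refine sum_congr rfl fun x _ => ?_; rw [Complex.norm_real, Real.norm_eq_abs, sq_abs]
  rw [l2_sq]
  have hterm : ∀ x, ‖(normalize (fun x => (u x : ℂ)) - normalize (fun x => (v x : ℂ))) x‖ ^ 2 = (u x / a - v x / b) ^ 2 := by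
    intro x
    simp only [QState.normalize, Pi.sub_apply, Pi.smul_apply, Complex.real_smul]
    rw [← ha, ← hb,
      show ((a⁻¹ : ℝ) : ℂ) * (u x : ℂ) - ((b⁻¹ : ℝ) : ℂ) * (v x : ℂ) = ((u x / a - v x / b : ℝ) : ℂ) by push_cast; ring,
      Complex.norm_real, Real.norm_eq_abs, sq_abs]
  simp_rw [hterm]
  have hexp : ∀ x, (u x / a - v x / b) ^ 2 = u x ^ 2 / a ^ 2 + v x ^ 2 / b ^ 2 - 2 * (u x * v x) / (a * b) := by
    intro x; field_simp; ring
  simp_rw [hexp]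
  rw [sum_sub_distrib, sum_add_distrib, ← sum_div, ← sum_div, ← sum_div, ← mul_sum, hua, hvb, div_self (pow_ne_zero _ ha0.ne'),
    div_self (pow_ne_zero _ hb0.ne')]
  ring

/-- **Nonnegative vectors making a small angle are close after normalisation**: if `⟨u,v⟩ ≥ κ‖u‖₂²` and
`‖v‖₂ ≤ ‖u‖₂` (`u, v ≠ 0`, entries real), then `‖û − v̂‖₂² ≤ 2(1 − κ)`. [folklore] -/
theorem l2_normalize_sub_normalize_sq_le {u v : X → ℝ} (hu : (fun x => (u x : ℂ)) ≠ 0) (hv : (fun x => (v x : ℂ)) ≠ 0) {κ : ℝ}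
    (hκ : 0 ≤ κ) (hinner : κ * l2 (fun x => (u x : ℂ)) ^ 2 ≤ ∑ x, u x * v x)
    (hvu : l2 (fun x => (v x : ℂ)) ≤ l2 (fun x => (u x : ℂ))) :
    l2 (normalize (fun x => (u x : ℂ)) - normalize (fun x => (v x : ℂ))) ^ 2 ≤ 2 * (1 - κ) := by
  rw [l2_normalize_sub_normalize_sq_eq hu hv]
  set a : ℝ := l2 (fun x => (u x : ℂ))
  set b : ℝ := l2 (fun x => (v x : ℂ))
  have ha0 : 0 < a := l2_pos hu
  have hb0 : 0 < b := l2_pos hv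
  have hkey : κ ≤ (∑ x, u x * v x) / (a * b) := by
    rw [le_div_iff₀ (mul_pos ha0 hb0)]
    calc κ * (a * b) ≤ κ * (a * a) := by gcongr
      _ = κ * a ^ 2 := by ring
      _ ≤ ∑ x, u x * v x := hinner
  have h2 : 2 * κ ≤ 2 * (∑ x, u x * v x) / (a * b) := by rw [mul_div_assoc]; linarith
  linarith

/-- The same with the conclusion as a bound on the distance: `‖û − v̂‖₂ ≤ √(2(1−κ))`. [folklore] -/
theorem l2_normalize_sub_normalize_le_sqrt {u v : X → ℝ} (hu : (fun x => (u x : ℂ)) ≠ 0) (hv : (fun x => (v x : ℂ)) ≠ 0) {κ : ℝ}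
    (hκ : 0 ≤ κ) (hinner : κ * l2 (fun x => (u x : ℂ)) ^ 2 ≤ ∑ x, u x * v x)
    (hvu : l2 (fun x => (v x : ℂ)) ≤ l2 (fun x => (u x : ℂ))) :
    l2 (normalize (fun x => (u x : ℂ)) - normalize (fun x => (v x : ℂ))) ≤ Real.sqrt (2 * (1 - κ)) := by
  rw [← Real.sqrt_sq (l2_nonneg _)]
  exact Real.sqrt_le_sqrt (l2_normalize_sub_normalize_sq_le hu hv hκ hinner hvu)

end NormalizeLemma

/-! ### The branch vectors -/

section Branch

variable {V : Type*} [NormedAddCommGroup V] [InnerProductSpace ℝ V]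
variable {ι : Type*} [Fintype ι]
variable (Λ : Submodule ℤ V) (e : Basis ι ℤ Λ) (R : ℕ)

open Classical in
/-- **The branch amplitude** on the branch `y`: `ψ_y(s) = Σ_{x ∈ Box, x − y ∈ x_s + RΛ} ρ(x)` — the
amplitude of `|s⟩` after the box register has been reduced modulo the lattice, the reduction `y` kept
in another register, and the coset of the lattice part read modulo `RΛ`. [cite: Regev2009, Lemma 3.12 (proof, p. 19) and Lemma 3.14 (proof, p. 20)] -/
def branchAmp (Box : Finset V) (y : V) (s : ι → ZMod R) : ℝ :=
  ∑ x ∈ Box.filter (fun x => ∃ z : Λ, x - y = reprPt Λ e R s + (R : ℝ) • (z : V)), gaussianFunction 1 x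

/-- The branch vector as a complex vector on `ℤ_Rⁿ`. [cite: Regev2009, Lemma 3.12 (proof)] -/
def branchVec (Box : Finset V) (y : V) : (ι → ZMod R) → ℂ := fun s => ((branchAmp Λ e R Box y s : ℝ) : ℂ)

/-- Branch amplitudes are nonnegative. [folklore] -/
theorem branchAmp_nonneg (Box : Finset V) (y : V) (s : ι → ZMod R) : 0 ≤ branchAmp Λ e R Box y s :=
  sum_nonneg fun _ _ => (gaussianFunction_pos _ _).le

/-- A box point of the coset contributes its weight. [folklore] -/
theorem gaussianFunction_le_branchAmp {Box : Finset V} {y : V} {s : ι → ZMod R} {x : V} (hx : x ∈ Box)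
    (z : Λ) (hxz : x - y = reprPt Λ e R s + (R : ℝ) • (z : V)) : gaussianFunction 1 x ≤ branchAmp Λ e R Box y s := by
  classical
  unfold branchAmp
  refine single_le_sum (f := fun x => gaussianFunction 1 x) (fun x _ => (gaussianFunction_pos _ _).le) ?_
  rw [mem_filter]
  exact ⟨hx, z, hxz⟩

/-! ### (A1) The perturbation inequality `ρ(x + y) ≥ (1 − π(2ρ₀Y + Y²)) ρ(x)` -/

/-- **`ρ₁(x + y) ≥ (1 − π(2ρ₀Y + Y²)) ρ₁(x)`** for `‖x‖ ≤ ρ₀`, `‖y‖ ≤ Y` (Regev's Claim 2.? "the numerator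
is at least `(1 − 2^{-Ω(n)})ρ_r(x)`", in explicit form: `‖x+y‖² − ‖x‖² = 2⟨x,y⟩ + ‖y‖² ≤ 2ρ₀Y + Y²` and
`e^{-t} ≥ 1 − t`). [cite: Regev2009, Lemma 3.12 (proof: "by Claim (clm:gaussianperturb), the numerator is at least (1−2^{−Ω(n)})ρ_r(x)")] -/
theorem gaussianFunction_add_ge {x y : V} {ρ₀ Y : ℝ} (hx : ‖x‖ ≤ ρ₀) (hy : ‖y‖ ≤ Y) :
    (1 - π * (2 * ρ₀ * Y + Y ^ 2)) * gaussianFunction 1 x ≤ gaussianFunction 1 (x + y) := by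
  have hρ₀ : 0 ≤ ρ₀ := (norm_nonneg _).trans hx
  unfold gaussianFunction
  simp only [one_pow, div_one]
  have hexp : Real.exp (-π * ‖x + y‖ ^ 2) = Real.exp (-π * ‖x‖ ^ 2) * Real.exp (-π * (‖x + y‖ ^ 2 - ‖x‖ ^ 2)) := by
    rw [← Real.exp_add]; congr 1; ring
  rw [hexp, mul_comm]
  apply mul_le_mul_of_nonneg_left _ (Real.exp_pos _).le
  -- `‖x+y‖² − ‖x‖² ≤ 2ρ₀Y + Y²`
  have hdiff : ‖x + y‖ ^ 2 - ‖x‖ ^ 2 ≤ 2 * ρ₀ * Y + Y ^ 2 := by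
    rw [norm_add_sq_real]
    have h1 : ⟪x, y⟫_ℝ ≤ ‖x‖ * ‖y‖ := real_inner_le_norm _ _
    have h2 : ‖x‖ * ‖y‖ ≤ ρ₀ * Y := mul_le_mul hx hy (norm_nonneg _) hρ₀
    have h3 : ‖y‖ ^ 2 ≤ Y ^ 2 := pow_le_pow_left₀ (norm_nonneg _) hy 2
    linarith
  calc 1 - π * (2 * ρ₀ * Y + Y ^ 2) ≤ 1 - π * (‖x + y‖ ^ 2 - ‖x‖ ^ 2) := by
        have := Real.pi_pos; nlinarith
    _ ≤ Real.exp (-π * (‖x + y‖ ^ 2 - ‖x‖ ^ 2)) := by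
        have := Real.add_one_le_exp (-π * (‖x + y‖ ^ 2 - ‖x‖ ^ 2)); linarith

/-! ### (A2) Summability over a coset and the termwise bound on `ϑ₂(s) ψ_y(s)` -/

/-- The Gaussian over the coset `x_s + RΛ`, indexed by `Λ`, is summable. [folklore] -/
theorem summable_gaussianFunction_coset [FiniteDimensional ℝ V] [DiscreteTopology Λ] [NeZero R] (s : ι → ZMod R) :
    Summable fun z : Λ => gaussianFunction 1 (reprPt Λ e R s + (R : ℝ) • (z : V)) := by
  have h := summable_gaussianFunction_sub (scaledLattice Λ R) one_ne_zero (-reprPt Λ e R s)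
  rw [← (scaledEquiv Λ R).summable_iff] at h
  refine h.congr fun z => ?_
  simp only [Function.comp_apply, coe_scaledEquiv, sub_neg_eq_add, add_comm]

/-- The same for the coset weighted by any bounded factor: the short-point integrand is summable. [folklore] -/
theorem summable_short_integrand [FiniteDimensional ℝ V] [DiscreteTopology Λ] [NeZero R] (s : ι → ZMod R) (y : V) :
    Summable fun z : Λ => {z : Λ | ‖reprPt Λ e R s + (R : ℝ) • (z : V)‖ < Real.sqrt (finrank ℝ V)}.indicator
      (fun z => gaussianFunction 1 (reprPt Λ e R s + (R : ℝ) • (z : V)) * gaussianFunction 1 (reprPt Λ e R s + (R : ℝ) • (z : V) + y)) z := by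
  refine Summable.of_nonneg_of_le (fun z => ?_) (fun z => ?_) (summable_gaussianFunction_coset Λ e R s)
  · exact Set.indicator_nonneg (fun _ _ => mul_nonneg (gaussianFunction_pos _ _).le (gaussianFunction_pos _ _).le) _
  · refine (Set.indicator_le_self' (fun _ _ => mul_nonneg (gaussianFunction_pos _ _).le (gaussianFunction_pos _ _).le) z).trans ?_
    have h1 : gaussianFunction 1 (reprPt Λ e R s + (R : ℝ) • (z : V) + y) ≤ 1 := by
      unfold gaussianFunction
      rw [Real.exp_le_one_iff]
      have := Real.pi_pos
      have : 0 ≤ ‖reprPt Λ e R s + (R : ℝ) • (z : V) + y‖ ^ 2 := sq_nonneg _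
      simp only [one_pow, div_one]
      nlinarith
    calc gaussianFunction 1 (reprPt Λ e R s + (R : ℝ) • (z : V)) * gaussianFunction 1 (reprPt Λ e R s + (R : ℝ) • (z : V) + y)
        ≤ gaussianFunction 1 (reprPt Λ e R s + (R : ℝ) • (z : V)) * 1 :=
          mul_le_mul_of_nonneg_left h1 (gaussianFunction_pos _ _).le
      _ = _ := mul_one _

/-- **The box contains the shifted short lattice points** (the one requirement on the register's box).
[cite: Regev2009, Lemma 3.12 (proof: "Since ℤⁿ ∩ √n r Bₙ ⊆ {−√n r,…,√n r}ⁿ")] -/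
def BoxCoversShort (Box : Finset V) (y : V) : Prop :=
  ∀ x ∈ Λ, ‖x‖ < Real.sqrt (finrank ℝ V) → x + y ∈ Box

/-- **Termwise: `ϑ₂(s) · ψ_y(s) ≥ Σ_{z : ‖x_s + Rz‖ < √n} ρ(x_s + Rz) ρ(x_s + Rz + y)`** — each short point of
the coset contributes `ρ(x)` to `ϑ₂(s)` and (being in the box after the shift) `ρ(x + y)` to `ψ_y(s)`.
[cite: Regev2009, Lemma 3.12 (proof)] -/
theorem periodicAmp_mul_branchAmp_ge [FiniteDimensional ℝ V] [DiscreteTopology Λ] [NeZero R] {Box : Finset V} {y : V}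
    (hBox : BoxCoversShort Λ Box y) (s : ι → ZMod R) :
    ∑' z : Λ, {z : Λ | ‖reprPt Λ e R s + (R : ℝ) • (z : V)‖ < Real.sqrt (finrank ℝ V)}.indicator
        (fun z => gaussianFunction 1 (reprPt Λ e R s + (R : ℝ) • (z : V)) *
          gaussianFunction 1 (reprPt Λ e R s + (R : ℝ) • (z : V) + y)) z ≤
      periodicAmp Λ e R s * branchAmp Λ e R Box y s := by
  have hT : periodicAmp Λ e R s = ∑' z : Λ, gaussianFunction 1 (reprPt Λ e R s + (R : ℝ) • (z : V)) := rfl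
  rw [hT, ← tsum_mul_right]
  refine (summable_short_integrand Λ e R s y).tsum_le_tsum (fun z => ?_)
    ((summable_gaussianFunction_coset Λ e R s).mul_right _)
  by_cases hz : ‖reprPt Λ e R s + (R : ℝ) • (z : V)‖ < Real.sqrt (finrank ℝ V)
  · rw [Set.indicator_of_mem (show z ∈ {z : Λ | ‖reprPt Λ e R s + (R : ℝ) • (z : V)‖ < Real.sqrt (finrank ℝ V)} from hz)]
    have h2 : (R : ℝ) • (z : V) ∈ Λ := by rw [Nat.cast_smul_eq_nsmul]; exact nsmul_mem z.2 R
    have hmem : reprPt Λ e R s + (R : ℝ) • (z : V) ∈ Λ := Λ.add_mem (reprPt_mem Λ e R s) h2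
    refine mul_le_mul_of_nonneg_left ?_ (gaussianFunction_pos _ _).le
    exact gaussianFunction_le_branchAmp Λ e R (hBox _ hmem hz) z (by rw [add_sub_cancel_right])
  · rw [Set.indicator_of_notMem (show z ∉ {z : Λ | ‖reprPt Λ e R s + (R : ℝ) • (z : V)‖ < Real.sqrt (finrank ℝ V)} from hz)]
    exact mul_nonneg (gaussianFunction_pos _ _).le (branchAmp_nonneg Λ e R Box y s)

/-! ### (A3) Summing over the cosets: `Σ_s Σ_{z} F(x_s + Rz) = Σ_{x ∈ Λ} F(x)` -/

/-- **Coset decomposition of a lattice sum**: `Σ_s Σ_{z ∈ Λ} F(x_s + Rz) = Σ_{x ∈ Λ} F(x)` for a summable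
`F` (every lattice point is uniquely `x_s + Rz`, `latticePt_eq_reprPt_add`). [cite: Regev2009, Lemma 3.14 (proof: "the natural mapping between L*/R ∩ P(L*) and ℤ_Rⁿ")] -/
theorem sum_tsum_coset_eq_tsum [DecidableEq ι] [NeZero R] (F : V → ℝ) (hF : Summable fun x : Λ => F x) :
    ∑ s : ι → ZMod R, ∑' z : Λ, F (reprPt Λ e R s + (R : ℝ) • (z : V)) = ∑' x : Λ, F x := by
  classical
  -- the summand in integer coordinates (pattern of `periodicAmp_character_sum`); `G` kept opaque
  obtain ⟨G, hG⟩ : ∃ G : (ι → ℤ) → ℝ, G = fun m => F (latticePt Λ e m) := ⟨_, rfl⟩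
  have hGsum : Summable G := by
    have h : Summable fun y : Λ => G (e.equivFun.toEquiv y) := by
      refine hF.congr fun y => ?_
      simp only [hG, LinearEquiv.coe_toEquiv, latticePt_equivFun]
    exact e.equivFun.toEquiv.summable_iff.1 h
  have hkey : ∀ (s : ι → ZMod R) (r : ι → ℤ), G (euclidEquiv R (s, r)) = F (reprPt Λ e R s + (R : ℝ) • latticePt Λ e r) := by
    intro s r
    simp only [hG]
    rw [latticePt_eq_reprPt_add Λ e R, Equiv.symm_apply_apply]
  -- (1) each coset sum in integer coordinates
  have h1 : ∀ s : ι → ZMod R, ∑' z : Λ, F (reprPt Λ e R s + (R : ℝ) • (z : V)) =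
      ∑' r : ι → ℤ, G (euclidEquiv R (s, r)) := by
    intro s
    rw [← e.equivFun.symm.toEquiv.tsum_eq]
    refine tsum_congr fun r => ?_
    rw [hkey]
    rfl
  -- (2) resum over `ℤⁿ`
  have h2 : ∑ s : ι → ZMod R, ∑' r : ι → ℤ, G (euclidEquiv R (s, r)) = ∑' m : ι → ℤ, G m := by
    have hs : Summable fun p : (ι → ZMod R) × (ι → ℤ) => G (euclidEquiv R p) :=
      (euclidEquiv R).summable_iff.2 hGsum
    rw [← (euclidEquiv R).tsum_eq G, hs.tsum_prod' (fun s => hs.comp_injective (Prod.mk_right_injective s)),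
      tsum_fintype]
  -- (3) back to the lattice
  have h3 : ∑' m : ι → ℤ, G m = ∑' x : Λ, F x := by
    rw [← e.equivFun.toEquiv.tsum_eq]
    refine tsum_congr fun x => ?_
    simp only [hG, LinearEquiv.coe_toEquiv, latticePt_equivFun]
  rw [Finset.sum_congr rfl fun s _ => h1 s, h2, h3]

/-! ### (A4) The mass of the short points and the lower bound on `⟨ϑ₂, ψ_y⟩` -/

/-- **Banaszczyk at parameter `1/√2`, radius `√n`**: the long points carry at most `b₁ⁿ` of the
`ρ_{1/√2}`-mass, `b₁ = √2·√(2πe)·e^{-2π}` (`< 0.011`). [cite: Banaszczyk1993, Lemma 1.5] -/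
theorem tsum_indicator_long_le [FiniteDimensional ℝ V] [MeasurableSpace V] [BorelSpace V] [DiscreteTopology Λ] [IsZLattice ℝ Λ] :
    ∑' x : Λ, {x : Λ | Real.sqrt (finrank ℝ V) ≤ ‖(x : V)‖}.indicator (fun x => gaussianFunction (Real.sqrt 2)⁻¹ (x : V)) x ≤
      (Real.sqrt 2 * Real.sqrt (2 * π * Real.exp 1) * Real.exp (-π * Real.sqrt 2 ^ 2)) ^ finrank ℝ V *
        ∑' x : Λ, gaussianFunction (Real.sqrt 2)⁻¹ (x : V) := by
  have hs : (0 : ℝ) < (Real.sqrt 2)⁻¹ := inv_pos.2 (Real.sqrt_pos.2 two_pos)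
  have hc : 1 / Real.sqrt (2 * π) ≤ Real.sqrt 2 := by
    rw [div_le_iff₀ (Real.sqrt_pos.2 (by positivity))]
    have h1 : (1 : ℝ) ≤ Real.sqrt 2 := Real.one_le_sqrt.2 (by norm_num)
    have h2 : (1 : ℝ) ≤ Real.sqrt (2 * π) := Real.one_le_sqrt.2 (by linarith [Real.pi_gt_three])
    nlinarith
  have h := tsum_indicator_gaussianFunction_le Λ hs hc
  have hset : {x : Λ | Real.sqrt 2 * (Real.sqrt 2)⁻¹ * Real.sqrt (finrank ℝ V) ≤ ‖(x : V)‖} =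
      {x : Λ | Real.sqrt (finrank ℝ V) ≤ ‖(x : V)‖} := by
    ext x; simp
  rwa [hset] at h

/-- Summability of `ρ_s` over the lattice (as a function of the lattice point). [folklore] -/
theorem summable_gaussianFunction_coe [FiniteDimensional ℝ V] [DiscreteTopology Λ] {σ : ℝ} (hσ : σ ≠ 0) :
    Summable fun x : Λ => gaussianFunction σ (x : V) := by
  have h := summable_gaussianFunction_sub Λ hσ (0 : V)
  simpa using h

/-- **(A) The lower bound on the inner product**: with `δ = π(2√n Y + Y²) ≤ 1`,
`Σ_s ϑ₂(s) ψ_y(s) ≥ (1 − δ)(1 − b₁ⁿ) · Σ_{x ∈ Λ} ρ_{1/√2}(x)`. [cite: Regev2009, Lemma 3.12 (proof)] -/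
theorem sum_periodicAmp_mul_branchAmp_ge [FiniteDimensional ℝ V] [MeasurableSpace V] [BorelSpace V] [DiscreteTopology Λ]
    [IsZLattice ℝ Λ] [DecidableEq ι] [NeZero R] {Box : Finset V} {y : V} {Y : ℝ} (hBox : BoxCoversShort Λ Box y) (hy : ‖y‖ ≤ Y)
    (hδ : π * (2 * Real.sqrt (finrank ℝ V) * Y + Y ^ 2) ≤ 1) :
    (1 - π * (2 * Real.sqrt (finrank ℝ V) * Y + Y ^ 2)) *
        (1 - (Real.sqrt 2 * Real.sqrt (2 * π * Real.exp 1) * Real.exp (-π * Real.sqrt 2 ^ 2)) ^ finrank ℝ V) *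
        ∑' x : Λ, gaussianFunction (Real.sqrt 2)⁻¹ (x : V) ≤
      ∑ s : ι → ZMod R, periodicAmp Λ e R s * branchAmp Λ e R Box y s := by
  set rn : ℝ := Real.sqrt (finrank ℝ V) with hrn
  set δ : ℝ := π * (2 * rn * Y + Y ^ 2) with hδdef
  set b : ℝ := (Real.sqrt 2 * Real.sqrt (2 * π * Real.exp 1) * Real.exp (-π * Real.sqrt 2 ^ 2)) ^ finrank ℝ V with hbdef
  have h1δ : 0 ≤ 1 - δ := by rw [hδdef]; linarith
  -- the short-point integrand and the short-point mass, as functions on `V`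
  set F : V → ℝ := fun x => if ‖x‖ < rn then gaussianFunction 1 x * gaussianFunction 1 (x + y) else 0 with hFdef
  set G : V → ℝ := fun x => if ‖x‖ < rn then gaussianFunction (Real.sqrt 2)⁻¹ x else 0 with hGdef
  have hρ1 : Summable fun x : Λ => gaussianFunction 1 (x : V) := summable_gaussianFunction_coe Λ one_ne_zero
  have hρ2 : Summable fun x : Λ => gaussianFunction (Real.sqrt 2)⁻¹ (x : V) :=
    summable_gaussianFunction_coe Λ (inv_ne_zero (Real.sqrt_ne_zero'.2 two_pos))
  have hle1 : ∀ v : V, gaussianFunction 1 v ≤ 1 := fun v => by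
    unfold gaussianFunction; rw [Real.exp_le_one_iff]
    have := Real.pi_pos; have := sq_nonneg ‖v‖; simp only [one_pow, div_one]; nlinarith
  have hF0 : ∀ x, 0 ≤ F x := fun x => by
    rw [hFdef]; dsimp only; split_ifs
    · exact mul_nonneg (gaussianFunction_pos _ _).le (gaussianFunction_pos _ _).le
    · exact le_rfl
  have hFle : ∀ x, F x ≤ gaussianFunction 1 x := fun x => by
    rw [hFdef]; dsimp only; split_ifs
    · calc gaussianFunction 1 x * gaussianFunction 1 (x + y) ≤ gaussianFunction 1 x * 1 :=
            mul_le_mul_of_nonneg_left (hle1 _) (gaussianFunction_pos _ _).le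
        _ = gaussianFunction 1 x := mul_one _
    · exact (gaussianFunction_pos _ _).le
  have hFsum : Summable fun x : Λ => F x := Summable.of_nonneg_of_le (fun x => hF0 x) (fun x => hFle x) hρ1
  have hG0 : ∀ x, 0 ≤ G x := fun x => by
    rw [hGdef]; dsimp only; split_ifs
    · exact (gaussianFunction_pos _ _).le
    · exact le_rfl
  have hGle : ∀ x, G x ≤ gaussianFunction (Real.sqrt 2)⁻¹ x := fun x => by
    rw [hGdef]; dsimp only; split_ifs
    · exact le_rfl
    · exact (gaussianFunction_pos _ _).le
  have hGsum : Summable fun x : Λ => G x := Summable.of_nonneg_of_le (fun x => hG0 x) (fun x => hGle x) hρ2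
  -- Step 1: `Σ_s ϑ₂ψ ≥ Σ_s Σ_z F(x_s + Rz) = Σ_{x∈Λ} F(x)`
  have hstep1 : ∑' x : Λ, F x ≤ ∑ s : ι → ZMod R, periodicAmp Λ e R s * branchAmp Λ e R Box y s := by
    rw [← sum_tsum_coset_eq_tsum Λ e R F hFsum]
    refine sum_le_sum fun s _ => ?_
    refine le_trans (le_of_eq ?_) (periodicAmp_mul_branchAmp_ge Λ e R hBox s)
    refine tsum_congr fun z => ?_
    rw [hFdef, Set.indicator_apply]
    rfl
  -- Step 2: termwise `F ≥ (1 − δ) G`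
  have hstep2 : (1 - δ) * ∑' x : Λ, G x ≤ ∑' x : Λ, F x := by
    rw [← tsum_mul_left]
    refine (hGsum.mul_left _).tsum_le_tsum (fun x => ?_) hFsum
    rw [hGdef, hFdef]; dsimp only
    split_ifs with hx
    · rw [← gaussianFunction_one_sq, sq]
      calc (1 - δ) * (gaussianFunction 1 (x : V) * gaussianFunction 1 (x : V))
          = gaussianFunction 1 (x : V) * ((1 - δ) * gaussianFunction 1 (x : V)) := by ring
        _ ≤ gaussianFunction 1 (x : V) * gaussianFunction 1 ((x : V) + y) :=
            mul_le_mul_of_nonneg_left (gaussianFunction_add_ge hx.le hy) (gaussianFunction_pos _ _).le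
    · simp
  -- Step 3: `Σ G = Σ ρ_{1/√2} − Σ_{long} ρ_{1/√2} ≥ (1 − b) Σ ρ_{1/√2}`
  have hstep3 : (1 - b) * ∑' x : Λ, gaussianFunction (Real.sqrt 2)⁻¹ (x : V) ≤ ∑' x : Λ, G x := by
    have hsplit : ∀ x : Λ, G x = gaussianFunction (Real.sqrt 2)⁻¹ (x : V) -
        {x : Λ | rn ≤ ‖(x : V)‖}.indicator (fun x => gaussianFunction (Real.sqrt 2)⁻¹ (x : V)) x := by
      intro x
      rw [hGdef, Set.indicator_apply]; dsimp only
      by_cases hx : ‖(x : V)‖ < rn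
      · rw [if_pos hx, if_neg (by rw [Set.mem_setOf_eq]; linarith)]; ring
      · rw [if_neg hx, if_pos (by rw [Set.mem_setOf_eq]; linarith)]; ring
    have hind : Summable fun x : Λ => {x : Λ | rn ≤ ‖(x : V)‖}.indicator (fun x => gaussianFunction (Real.sqrt 2)⁻¹ (x : V)) x :=
      Summable.of_nonneg_of_le (fun x => Set.indicator_nonneg (fun _ _ => (gaussianFunction_pos _ _).le) _)
        (fun x => Set.indicator_le_self' (fun _ _ => (gaussianFunction_pos _ _).le) x) hρ2
    rw [tsum_congr hsplit, hρ2.tsum_sub hind]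
    have hban := tsum_indicator_long_le Λ
    rw [← hbdef, ← hrn] at hban
    linarith
  -- combine
  have hρ2nn : 0 ≤ ∑' x : Λ, gaussianFunction (Real.sqrt 2)⁻¹ (x : V) := tsum_nonneg fun x => (gaussianFunction_pos _ _).le
  calc (1 - δ) * (1 - b) * ∑' x : Λ, gaussianFunction (Real.sqrt 2)⁻¹ (x : V)
      = (1 - δ) * ((1 - b) * ∑' x : Λ, gaussianFunction (Real.sqrt 2)⁻¹ (x : V)) := by ring
    _ ≤ (1 - δ) * ∑' x : Λ, G x := mul_le_mul_of_nonneg_left hstep3 h1δ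
    _ ≤ ∑' x : Λ, F x := hstep2
    _ ≤ _ := hstep1


/-! ### (B) `‖ψ_y‖ ≤ ‖ϑ₂‖`: the shifted coset sums and the coupling lattice -/

/-- **The full shifted coset sum** `ψ̃_y(s) = Σ_{z ∈ Λ} ρ(x_s + Rz + y)` (the branch amplitude without the
box truncation). [cite: Regev2009, Lemma 3.12 (proof: "ρ_r(L + y)")] -/
def shiftAmp (y : V) (s : ι → ZMod R) : ℝ := ∑' z : Λ, gaussianFunction 1 (reprPt Λ e R s + (R : ℝ) • (z : V) + y)

/-- Summability of the shifted coset Gaussian. [folklore] -/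
theorem summable_gaussianFunction_coset_add [FiniteDimensional ℝ V] [DiscreteTopology Λ] [NeZero R] (y : V) (s : ι → ZMod R) :
    Summable fun z : Λ => gaussianFunction 1 (reprPt Λ e R s + (R : ℝ) • (z : V) + y) := by
  have h := summable_gaussianFunction_sub (scaledLattice Λ R) one_ne_zero (-(reprPt Λ e R s + y))
  rw [← (scaledEquiv Λ R).summable_iff] at h
  refine h.congr fun z => ?_
  simp only [Function.comp_apply, coe_scaledEquiv, sub_neg_eq_add]
  congr 1
  abel

/-- **`ψ_y(s) ≤ ψ̃_y(s)`**: the box points of the coset, shifted back by `y`, are distinct points of the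
coset. [cite: Regev2009, Lemma 3.12 (proof)] -/
theorem branchAmp_le_shiftAmp [FiniteDimensional ℝ V] [DiscreteTopology Λ] [NeZero R] (Box : Finset V) (y : V)
    (s : ι → ZMod R) : branchAmp Λ e R Box y s ≤ shiftAmp Λ e R y s := by
  classical
  unfold branchAmp shiftAmp
  set S := Box.filter (fun x => ∃ z : Λ, x - y = reprPt Λ e R s + (R : ℝ) • (z : V)) with hS
  have hz : ∀ x ∈ S, ∃ z : Λ, x - y = reprPt Λ e R s + (R : ℝ) • (z : V) := fun x hx => (mem_filter.1 hx).2
  choose! g hg using hz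
  have hinj : Set.InjOn g S := by
    intro x hx x' hx' hxx
    have h1 := hg x hx
    have h2 := hg x' hx'
    rw [← hxx] at h2
    exact sub_left_injective (h1.trans h2.symm)
  calc ∑ x ∈ S, gaussianFunction 1 x
      = ∑ z ∈ S.image g, gaussianFunction 1 (reprPt Λ e R s + (R : ℝ) • (z : V) + y) := by
        rw [sum_image hinj]
        refine sum_congr rfl fun x hx => ?_
        rw [← hg x hx, sub_add_cancel]
    _ ≤ ∑' z : Λ, gaussianFunction 1 (reprPt Λ e R s + (R : ℝ) • (z : V) + y) :=
        (summable_gaussianFunction_coset_add Λ e R y s).sum_le_tsum _ (fun z _ => (gaussianFunction_pos _ _).le)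

/-- `ψ̃_y(s)` as a Gaussian mass: `ψ̃_y(s) = ρ(RΛ + x_s + y)`. [folklore] -/
theorem shiftAmp_eq_toReal [FiniteDimensional ℝ V] [DiscreteTopology Λ] [NeZero R] (y : V) (s : ι → ZMod R) :
    shiftAmp Λ e R y s = (gaussianMass 1 (-(reprPt Λ e R s + y)) (scaledLattice Λ R : Set V)).toReal := by
  rw [gaussianMass_coe_eq_ofReal_tsum (scaledLattice Λ R) one_ne_zero,
    ENNReal.toReal_ofReal (tsum_nonneg fun _ => (gaussianFunction_pos _ _).le), shiftAmp, ← (scaledEquiv Λ R).tsum_eq]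
  refine tsum_congr fun z => ?_
  rw [coe_scaledEquiv, sub_neg_eq_add]
  congr 1
  abel

omit [InnerProductSpace ℝ V] in
/-- **`ρ_{(-y,-y)}(M) = Σ_{x ∈ S} ρ(x + y + L)²`**: the centred version of `gaussianMass_couplingLattice_eq`
(`ρ((x + y₁ + y, x + y₂ + y)) = ρ(x + y₁ + y) ρ(x + y₂ + y)` summed along `S × L × L ≃ M`).
[cite: Regev2009, Claim 3.13 (proof: "ρ(M) = Σ ρ(x + L)²")] -/
theorem IsTransversal.gaussianMass_couplingLattice_center_eq {T L : Submodule ℤ V} {S : Finset V} (hS : IsTransversal T L S)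
    (hLT : L ≤ T) (σ : ℝ) (y : V) :
    gaussianMass σ (WithLp.toLp 2 (-y, -y)) (couplingLattice T L : Set (WithLp 2 (V × V))) =
      ∑ x ∈ S, gaussianMass σ (-(x + y)) (L : Set V) ^ 2 := by
  have h1 : gaussianMass σ (WithLp.toLp 2 (-y, -y)) (couplingLattice T L : Set (WithLp 2 (V × V))) =
      ∑' q : S × L × L, ENNReal.ofReal (gaussianFunction σ ((q.1 : V) + q.2.1 + y)) *
        ENNReal.ofReal (gaussianFunction σ ((q.1 : V) + q.2.2 + y)) := by
    unfold gaussianMass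
    rw [← (hS.paramEquiv hLT).tsum_eq]
    refine tsum_congr fun q => ?_
    rw [← ENNReal.ofReal_mul (gaussianFunction_pos _ _).le]
    congr 1
    change gaussianFunction σ (WithLp.toLp 2 ((q.1 : V) + q.2.1, (q.1 : V) + q.2.2) - WithLp.toLp 2 (-y, -y)) = _
    rw [← WithLp.toLp_sub, Prod.mk_sub_mk, sub_neg_eq_add, sub_neg_eq_add, gaussianFunction_prod]
    rfl
  rw [h1, ENNReal.tsum_prod', tsum_fintype, Finset.sum_coe_sort S (fun x => ∑' c : ↥L × ↥L,
    ENNReal.ofReal (gaussianFunction σ (x + c.1 + y)) * ENNReal.ofReal (gaussianFunction σ (x + c.2 + y)))]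
  refine Finset.sum_congr rfl fun x _ => ?_
  rw [ENNReal.tsum_prod', sq, gaussianMass_submodule, ← ENNReal.tsum_mul_right]
  refine tsum_congr fun y1 => ?_
  rw [← ENNReal.tsum_mul_left]
  refine tsum_congr fun y2 => ?_
  rw [sub_neg_eq_add, sub_neg_eq_add, show ((y1 : L) : V) + (x + y) = x + y1 + y by abel,
    show ((y2 : L) : V) + (x + y) = x + y2 + y by abel]

/-- **`Σ_s ψ̃_y(s)² = ρ_{(-y,-y)}(M)`** for the coupling lattice `M` of `RΛ ≤ Λ` and the transversal
`{x_s}`. [cite: Regev2009, Claim 3.13 (proof), Lemma 3.12 (proof)] -/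
theorem sum_shiftAmp_sq_eq [FiniteDimensional ℝ V] [DiscreteTopology Λ] [DecidableEq ι] [NeZero R] (y : V) :
    ∑ s : ι → ZMod R, shiftAmp Λ e R y s ^ 2 =
      (gaussianMass 1 (WithLp.toLp 2 (-y, -y)) (couplingLattice Λ (scaledLattice Λ R) : Set (WithLp 2 (V × V)))).toReal := by
  rw [(isTransversal_reprSet Λ e R).gaussianMass_couplingLattice_center_eq (scaledLattice_le Λ R) 1 y,
    ENNReal.toReal_sum (fun x _ => ENNReal.pow_ne_top (gaussianMass_lattice_ne_top (scaledLattice Λ R) one_ne_zero _)),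
    sum_reprSet]
  refine Finset.sum_congr rfl fun s _ => ?_
  rw [ENNReal.toReal_pow, shiftAmp_eq_toReal]

/-- **`‖ϑ₂‖² = ρ(M)`** in coordinates: `Σ_s ϑ₂(s)² = ρ(M)`. [cite: Regev2009, Claim 3.13 (proof: "ρ(M) = Z²")] -/
theorem sum_periodicAmp_sq_eq [FiniteDimensional ℝ V] [DiscreteTopology Λ] [DecidableEq ι] [NeZero R] :
    ∑ s : ι → ZMod R, periodicAmp Λ e R s ^ 2 =
      (gaussianMass 1 0 (couplingLattice Λ (scaledLattice Λ R) : Set (WithLp 2 (V × V)))).toReal := by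
  rw [(isTransversal_reprSet Λ e R).gaussianMass_couplingLattice_eq (scaledLattice_le Λ R) 1,
    ENNReal.toReal_sum (fun x _ => ENNReal.pow_ne_top (gaussianMass_lattice_ne_top (scaledLattice Λ R) one_ne_zero _)),
    sum_reprSet]
  refine Finset.sum_congr rfl fun s _ => ?_
  rw [ENNReal.toReal_pow, periodicAmp_eq_toReal_gaussianMass]

/-- **(B) `‖ψ_y‖ ≤ ‖ϑ₂‖`**: `Σ_s ψ_y(s)² ≤ Σ_s ψ̃_y(s)² = ρ_{(-y,-y)}(M) ≤ ρ(M) = Σ_s ϑ₂(s)²` (the coset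
inequality for the discrete subgroup `M` of `V × V`). [cite: Regev2009, Lemma 3.12 (proof: "ρ_r(L+y) ≤ (1+2^{-Ω(n)}) det(L*) rⁿ"), MicciancioRegev2007, Lemma 2.9] -/
theorem sum_branchAmp_sq_le [FiniteDimensional ℝ V] [DiscreteTopology Λ] [DecidableEq ι] [NeZero R] (Box : Finset V) (y : V) :
    ∑ s : ι → ZMod R, branchAmp Λ e R Box y s ^ 2 ≤ ∑ s : ι → ZMod R, periodicAmp Λ e R s ^ 2 := by
  set M := couplingLattice Λ (scaledLattice Λ R) with hM
  calc ∑ s : ι → ZMod R, branchAmp Λ e R Box y s ^ 2 ≤ ∑ s : ι → ZMod R, shiftAmp Λ e R y s ^ 2 :=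
        sum_le_sum fun s _ => pow_le_pow_left₀ (branchAmp_nonneg Λ e R Box y s) (branchAmp_le_shiftAmp Λ e R Box y s) 2
    _ = (gaussianMass 1 (WithLp.toLp 2 (-y, -y)) (M : Set (WithLp 2 (V × V)))).toReal := sum_shiftAmp_sq_eq Λ e R y
    _ ≤ (gaussianMass 1 0 (M : Set (WithLp 2 (V × V)))).toReal :=
        ENNReal.toReal_mono (gaussianMass_lattice_ne_top M one_ne_zero 0)
          (gaussianMass_le_gaussianMass_zero_of_discrete M one_pos _)
    _ = ∑ s : ι → ZMod R, periodicAmp Λ e R s ^ 2 := (sum_periodicAmp_sq_eq Λ e R).symm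

/-! ### (C) `ρ(M) ≤ ρ_{1/√2}(Λ)/(1 − 4⁻ⁿ)`: the diagonal carries almost all of `M` -/

/-- **(C)** If `RΛ` has no nonzero vector of norm `< 2√n`, then `(1 − 4⁻ⁿ) ρ(M) ≤ ρ_{1/√2}(Λ)`: a pair
`(w₁, w₂) ∈ M` inside the ball `√(2n) B_{2n}` has `‖w₁ − w₂‖ ≤ √2‖w‖ < 2√n`, hence `w₁ = w₂ ∈ Λ`
(the diagonal, of mass `Σ ρ(x)² = ρ_{1/√2}(Λ)`), and the rest of `M` has mass `≤ 2^{-2n}ρ(M)`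
(Banaszczyk in dimension `2n`). [cite: Regev2009, Claim 3.13 (proof: "M′ ⊂ M ∖ √(2n)B", "if y ∈ L∖{0} then … at least 2√n")] -/
theorem gaussianMass_couplingLattice_toReal_le [FiniteDimensional ℝ V] [DiscreteTopology Λ] [IsZLattice ℝ Λ] [NeZero R]
    (hsvΛ : ∀ z ∈ scaledLattice Λ R, ‖z‖ < 2 * Real.sqrt (finrank ℝ V) → z = 0) :
    (1 - 4⁻¹ ^ finrank ℝ V) * (gaussianMass 1 0 (couplingLattice Λ (scaledLattice Λ R) : Set (WithLp 2 (V × V)))).toReal ≤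
      ∑' x : Λ, gaussianFunction (Real.sqrt 2)⁻¹ (x : V) := by
  haveI : Fact (scaledLattice Λ R ≤ Λ) := ⟨scaledLattice_le Λ R⟩
  set M := couplingLattice Λ (scaledLattice Λ R) with hM
  set n := finrank ℝ V with hn
  set Sh : ℝ := ∑' x : Λ, gaussianFunction (Real.sqrt 2)⁻¹ (x : V) with hSh
  have hSh0 : 0 ≤ Sh := tsum_nonneg fun _ => (gaussianFunction_pos _ _).le
  have hfin : gaussianMass 1 0 (M : Set (WithLp 2 (V × V))) ≠ ⊤ := gaussianMass_lattice_ne_top M one_ne_zero 0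
  -- Banaszczyk on `M` (dimension `2n`)
  have hB := gaussianMass_diff_ball_le_holds M one_pos
  rw [one_mul, finrank_withLp_prod] at hB
  set B : Set (WithLp 2 (V × V)) := ball (0 : WithLp 2 (V × V)) (Real.sqrt ((2 * n : ℕ) : ℝ)) with hBdef
  -- the ball part of `M` lies on the diagonal
  set D : Set (WithLp 2 (V × V)) := {w | w.fst = w.snd ∧ w.fst ∈ Λ} with hDdef
  have hsub : (M : Set (WithLp 2 (V × V))) ∩ B ⊆ D := by
    rintro w ⟨hwM, hwB⟩
    obtain ⟨hw1, -, hw12⟩ := (mem_couplingLattice (T := Λ) (L := scaledLattice Λ R)).1 hwM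
    refine ⟨?_, hw1⟩
    by_contra hne
    have hnorm : 2 * Real.sqrt n ≤ ‖w.fst - w.snd‖ :=
      le_of_not_gt fun hlt => hne (sub_eq_zero.1 (hsvΛ _ hw12 hlt))
    have hwB' : ‖w‖ < Real.sqrt ((2 * n : ℕ) : ℝ) := by
      rw [hBdef, Metric.mem_ball, dist_zero_right] at hwB; exact hwB
    have h1 : ‖w.fst - w.snd‖ ≤ ‖w.fst‖ + ‖w.snd‖ := norm_sub_le _ _
    have h2 : (‖w.fst‖ + ‖w.snd‖) ^ 2 ≤ 2 * ‖w‖ ^ 2 := by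
      rw [WithLp.prod_norm_sq_eq_of_L2]
      nlinarith [sq_nonneg (‖w.fst‖ - ‖w.snd‖)]
    have h3 : ‖w‖ ^ 2 < 2 * n := by
      have h2n : (Real.sqrt ((2 * n : ℕ) : ℝ)) ^ 2 = 2 * n := by
        rw [Real.sq_sqrt (Nat.cast_nonneg _)]; push_cast; ring
      rw [← h2n]
      exact pow_lt_pow_left₀ hwB' (norm_nonneg _) two_ne_zero
    have h4 : (2 * Real.sqrt n) ^ 2 = 4 * n := by rw [mul_pow, Real.sq_sqrt (Nat.cast_nonneg _)]; ring
    have h5 : (2 * Real.sqrt n) ^ 2 ≤ ‖w.fst - w.snd‖ ^ 2 := pow_le_pow_left₀ (by positivity) hnorm 2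
    have h6 : ‖w.fst - w.snd‖ ^ 2 ≤ (‖w.fst‖ + ‖w.snd‖) ^ 2 := pow_le_pow_left₀ (norm_nonneg _) h1 2
    linarith
  -- the diagonal has mass `ρ_{1/√2}(Λ)`
  have hD : gaussianMass 1 0 D = ENNReal.ofReal Sh := by
    let f : Λ → D := fun x => ⟨WithLp.toLp 2 ((x : V), (x : V)), rfl, x.2⟩
    have hf : Function.Bijective f := by
      constructor
      · intro a b h
        have h' := congrArg (fun w : D => (w : WithLp 2 (V × V)).fst) h
        exact Subtype.ext h'
      · rintro ⟨w, hw1, hw2⟩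
        refine ⟨⟨w.fst, hw2⟩, Subtype.ext ?_⟩
        change WithLp.toLp 2 (w.fst, w.fst) = w
        exact (congrArg (fun v => WithLp.toLp 2 (w.fst, v)) hw1).trans rfl
    unfold gaussianMass
    rw [← (Equiv.ofBijective f hf).tsum_eq, hSh, ENNReal.ofReal_tsum_of_nonneg (fun _ => (gaussianFunction_pos _ _).le)
      (summable_gaussianFunction_coe Λ (inv_ne_zero (Real.sqrt_ne_zero'.2 two_pos)))]
    refine tsum_congr fun x => ?_
    rw [Equiv.ofBijective_apply, sub_zero, ← gaussianFunction_one_sq, sq]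
    change ENNReal.ofReal (gaussianFunction 1 (WithLp.toLp 2 ((x : V), (x : V)))) = _
    rw [gaussianFunction_prod]
    rfl
  -- `ρ(M) ≤ ρ_{1/√2}(Λ) + 4⁻ⁿ ρ(M)` in `ℝ≥0∞`
  have hsplit := gaussianMass_eq_inter_add_diff 1 (0 : WithLp 2 (V × V)) (M : Set (WithLp 2 (V × V))) B
  have hle : gaussianMass 1 0 (M : Set (WithLp 2 (V × V))) ≤
      ENNReal.ofReal Sh + (2⁻¹ : ℝ≥0∞) ^ (2 * n) * gaussianMass 1 0 (M : Set (WithLp 2 (V × V))) := by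
    calc gaussianMass 1 0 (M : Set (WithLp 2 (V × V)))
        = gaussianMass 1 0 ((M : Set (WithLp 2 (V × V))) ∩ B) + gaussianMass 1 0 ((M : Set (WithLp 2 (V × V))) \ B) := hsplit
      _ ≤ gaussianMass 1 0 D + (2⁻¹ : ℝ≥0∞) ^ (2 * n) * gaussianMass 1 0 (M : Set (WithLp 2 (V × V))) :=
          add_le_add (gaussianMass_mono _ _ hsub) hB
      _ = _ := by rw [hD]
  -- pass to reals
  have htop2 : (2⁻¹ : ℝ≥0∞) ^ (2 * n) * gaussianMass 1 0 (M : Set (WithLp 2 (V × V))) ≠ ⊤ :=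
    ENNReal.mul_ne_top (ENNReal.pow_ne_top (by simp)) hfin
  have hr := ENNReal.toReal_mono (ENNReal.add_ne_top.2 ⟨ENNReal.ofReal_ne_top, htop2⟩) hle
  rw [ENNReal.toReal_add ENNReal.ofReal_ne_top htop2, ENNReal.toReal_ofReal hSh0, ENNReal.toReal_mul, ENNReal.toReal_pow,
    ENNReal.toReal_inv, ENNReal.toReal_ofNat] at hr
  have h4 : (4⁻¹ : ℝ) ^ n = (2⁻¹ : ℝ) ^ (2 * n) := by rw [pow_mul]; norm_num
  rw [h4]
  linarith

/-! ### (D) The distance between the normalised branch vector and `ϑ̂₂`, `ϑ̂₁` -/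

/-- **Banaszczyk's constant at ratio `√2`**: `b₁ = √2 · √(2πe) · e^{-2π}` (`≈ 0.0109`), the base of the
bound `b₁ⁿ` on the mass of `Λ ∖ √n B` under `ρ_{1/√2}`. [cite: Banaszczyk1993, Lemma 1.5] -/
def banaConst : ℝ := Real.sqrt 2 * Real.sqrt (2 * π * Real.exp 1) * Real.exp (-π * Real.sqrt 2 ^ 2)

/-- `0 ≤ b₁`. [folklore] -/
theorem banaConst_nonneg : 0 ≤ banaConst := by unfold banaConst; positivity

/-- **`b₁ ≤ 2⁻⁶`** (`√(4πe) ≤ 5.85`, `e^{-2π} ≤ e^{-6} ≤ 1/403`). [folklore] -/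
theorem banaConst_le : banaConst ≤ (2⁻¹ : ℝ) ^ 6 := by
  unfold banaConst
  have hA : Real.sqrt 2 * Real.sqrt (2 * π * Real.exp 1) ≤ 5.85 := by
    rw [← Real.sqrt_mul zero_le_two]
    have h : 2 * (2 * π * Real.exp 1) ≤ (5.85 : ℝ) ^ 2 := by
      nlinarith [Real.pi_pos, Real.exp_pos 1, Real.pi_lt_d4, Real.exp_one_lt_d9]
    calc Real.sqrt (2 * (2 * π * Real.exp 1)) ≤ Real.sqrt ((5.85 : ℝ) ^ 2) := Real.sqrt_le_sqrt h
      _ = 5.85 := Real.sqrt_sq (by norm_num)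
  have hA0 : 0 ≤ Real.sqrt 2 * Real.sqrt (2 * π * Real.exp 1) := by positivity
  have hE : Real.exp (-π * Real.sqrt 2 ^ 2) ≤ 1 / 403 := by
    rw [Real.sq_sqrt zero_le_two]
    have h6 : Real.exp (-π * 2) ≤ Real.exp (-6) := Real.exp_le_exp.2 (by nlinarith [Real.pi_gt_three])
    have hexp6 : (403 : ℝ) ≤ Real.exp 6 := by
      have h := Real.exp_one_gt_d9
      have hpow : Real.exp 6 = Real.exp 1 ^ 6 := by rw [Real.exp_one_pow]; norm_num
      rw [hpow]
      have h0 : (0 : ℝ) ≤ 2.7182818283 := by norm_num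
      calc (403 : ℝ) ≤ 2.7182818283 ^ 6 := by norm_num
        _ ≤ Real.exp 1 ^ 6 := pow_le_pow_left₀ h0 h.le 6
    calc Real.exp (-π * 2) ≤ Real.exp (-6) := h6
      _ = 1 / Real.exp 6 := by rw [Real.exp_neg, one_div]
      _ ≤ 1 / 403 := one_div_le_one_div_of_le (by norm_num) hexp6
  calc Real.sqrt 2 * Real.sqrt (2 * π * Real.exp 1) * Real.exp (-π * Real.sqrt 2 ^ 2) ≤ 5.85 * (1 / 403) :=
        mul_le_mul hA hE (Real.exp_pos _).le (by norm_num)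
    _ ≤ (2⁻¹ : ℝ) ^ 6 := by norm_num

omit [InnerProductSpace ℝ V] in
/-- `x_0 = 0`. [folklore] -/
theorem reprPt_zero [NeZero R] : reprPt Λ e R 0 = 0 := by
  simp [reprPt, latticePt]

/-- **(D) Regev 2009, Lemma 3.12 for the branch `y` (coset-register form): the normalised branch vector is
within `√(2(δ + b₁ⁿ + 4⁻ⁿ))` of `ϑ̂₂`**, `δ = π(2√n Y + Y²)`, whenever `‖y‖ ≤ Y`, `δ ≤ 1`, the box contains
the `y`-shifts of the short lattice points, and `RΛ` has no nonzero vector shorter than `2√n`.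
[cite: Regev2009, Lemma 3.12 (proof, p. 19), Claim 3.13] -/
theorem l2_normalize_branchVec_sub_normalize_thetaTwo_le [FiniteDimensional ℝ V] [MeasurableSpace V] [BorelSpace V]
    [DiscreteTopology Λ] [IsZLattice ℝ Λ] [DecidableEq ι] [NeZero R] [Nontrivial V] {Box : Finset V} {y : V} {Y : ℝ}
    (hsvΛ : ∀ z ∈ scaledLattice Λ R, ‖z‖ < 2 * Real.sqrt (finrank ℝ V) → z = 0)
    (hBox : BoxCoversShort Λ Box y) (hy : ‖y‖ ≤ Y) (hδ : π * (2 * Real.sqrt (finrank ℝ V) * Y + Y ^ 2) ≤ 1) :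
    l2 (normalize (branchVec Λ e R Box y) - normalize (thetaTwo Λ e R)) ≤
      Real.sqrt (2 * (π * (2 * Real.sqrt (finrank ℝ V) * Y + Y ^ 2) + banaConst ^ finrank ℝ V + 4⁻¹ ^ finrank ℝ V)) := by
  set n := finrank ℝ V with hn
  set δ : ℝ := π * (2 * Real.sqrt n * Y + Y ^ 2) with hδdef
  set b : ℝ := banaConst ^ n with hbdef
  set c : ℝ := (4⁻¹ : ℝ) ^ n with hcdef
  have hY : 0 ≤ Y := (norm_nonneg _).trans hy
  have hδ0 : 0 ≤ δ := by rw [hδdef]; have := Real.pi_pos; positivity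
  have hb0 : 0 ≤ b := pow_nonneg banaConst_nonneg _
  have hb1 : b ≤ 1 := pow_le_one₀ banaConst_nonneg (banaConst_le.trans (by norm_num))
  have hc0 : 0 ≤ c := by positivity
  have hc1 : c ≤ 1 := pow_le_one₀ (by norm_num) (by norm_num)
  -- the two vectors
  have hu : (fun s : ι → ZMod R => ((periodicAmp Λ e R s : ℝ) : ℂ)) ≠ 0 := fun h => by
    have h0 := congrFun h 0
    simp only [Pi.zero_apply, Complex.ofReal_eq_zero] at h0
    exact (periodicAmp_pos Λ e 0).ne' h0
  have hv : (fun s : ι → ZMod R => ((branchAmp Λ e R Box y s : ℝ) : ℂ)) ≠ 0 := fun h => by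
    have h0 := congrFun h 0
    simp only [Pi.zero_apply, Complex.ofReal_eq_zero] at h0
    have hn0 : ‖(0 : V)‖ < Real.sqrt n := by
      rw [norm_zero]; exact Real.sqrt_pos.2 (by rw [hn]; exact_mod_cast Module.finrank_pos)
    have hyB : (0 : V) + y ∈ Box := hBox 0 Λ.zero_mem hn0
    have hle := gaussianFunction_le_branchAmp Λ e R (s := 0) hyB (0 : Λ)
      (by rw [reprPt_zero, Submodule.coe_zero, smul_zero, add_zero, zero_add, sub_self])
    linarith [gaussianFunction_pos 1 ((0 : V) + y)]
  -- `⟨ϑ₂, ψ⟩ ≥ κ ‖ϑ₂‖²` with `κ = (1-δ)(1-b)(1-c)`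
  have hl2sq : l2 (fun s : ι → ZMod R => ((periodicAmp Λ e R s : ℝ) : ℂ)) ^ 2 = ∑ s, periodicAmp Λ e R s ^ 2 := by
    rw [l2_sq]
    refine sum_congr rfl fun s _ => ?_
    rw [Complex.norm_real, Real.norm_eq_abs, sq_abs]
  have hA := sum_periodicAmp_mul_branchAmp_ge Λ e R hBox hy hδ
  have hC := gaussianMass_couplingLattice_toReal_le Λ R hsvΛ
  rw [← sum_periodicAmp_sq_eq Λ e R] at hC
  have hinner : (1 - δ) * (1 - b) * (1 - c) * l2 (fun s : ι → ZMod R => ((periodicAmp Λ e R s : ℝ) : ℂ)) ^ 2 ≤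
      ∑ s, periodicAmp Λ e R s * branchAmp Λ e R Box y s := by
    rw [hl2sq]
    have h1 : 0 ≤ (1 - δ) * (1 - b) := mul_nonneg (by linarith) (by linarith)
    calc (1 - δ) * (1 - b) * (1 - c) * ∑ s, periodicAmp Λ e R s ^ 2
        = (1 - δ) * (1 - b) * ((1 - c) * ∑ s, periodicAmp Λ e R s ^ 2) := by ring
      _ ≤ (1 - δ) * (1 - b) * ∑' x : Λ, gaussianFunction (Real.sqrt 2)⁻¹ (x : V) := mul_le_mul_of_nonneg_left hC h1
      _ ≤ _ := hA
  -- `‖ψ‖ ≤ ‖ϑ₂‖`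
  have hvu : l2 (fun s : ι → ZMod R => ((branchAmp Λ e R Box y s : ℝ) : ℂ)) ≤
      l2 (fun s : ι → ZMod R => ((periodicAmp Λ e R s : ℝ) : ℂ)) := by
    have hsq : l2 (fun s : ι → ZMod R => ((branchAmp Λ e R Box y s : ℝ) : ℂ)) ^ 2 ≤
        l2 (fun s : ι → ZMod R => ((periodicAmp Λ e R s : ℝ) : ℂ)) ^ 2 := by
      rw [hl2sq, l2_sq]
      refine le_trans (le_of_eq ?_) (sum_branchAmp_sq_le Λ e R Box y)
      refine sum_congr rfl fun s _ => ?_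
      rw [Complex.norm_real, Real.norm_eq_abs, sq_abs]
    exact (pow_le_pow_iff_left₀ (l2_nonneg _) (l2_nonneg _) two_ne_zero).1 hsq
  have hκ : 0 ≤ (1 - δ) * (1 - b) * (1 - c) := mul_nonneg (mul_nonneg (by linarith) (by linarith)) (by linarith)
  have hmain := l2_normalize_sub_normalize_le_sqrt hu hv hκ hinner hvu
  rw [l2_sub_comm]
  refine hmain.trans (Real.sqrt_le_sqrt ?_)
  nlinarith [mul_nonneg (mul_nonneg hδ0 hb0) hc0, mul_nonneg hδ0 hc0, mul_nonneg hb0 hc0, mul_nonneg hδ0 hb0,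
    mul_le_of_le_one_right (mul_nonneg hδ0 hb0) hc1]

/-- **(D′) … and within `√(2(δ + b₁ⁿ + 4⁻ⁿ)) + 2·2⁻ⁿ` of `ϑ̂₁`**, the input state of
`Regev2009.lemma_3_14_ideal` (Claim 3.13: `‖ϑ̂₂ − ϑ̂₁‖ ≤ 2·2⁻ⁿ`). [cite: Regev2009, Lemma 3.12, Claim 3.13, Lemma 3.14 (proof, p. 20)] -/
theorem l2_normalize_branchVec_sub_normalize_thetaOne_le [FiniteDimensional ℝ V] [MeasurableSpace V] [BorelSpace V]
    [DiscreteTopology Λ] [IsZLattice ℝ Λ] [DecidableEq ι] [NeZero R] [Nontrivial V] {Box : Finset V} {y : V} {Y : ℝ}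
    (hsvΛ : ∀ z ∈ scaledLattice Λ R, ‖z‖ < 2 * Real.sqrt (finrank ℝ V) → z = 0)
    (hBox : BoxCoversShort Λ Box y) (hy : ‖y‖ ≤ Y) (hδ : π * (2 * Real.sqrt (finrank ℝ V) * Y + Y ^ 2) ≤ 1) :
    l2 (normalize (branchVec Λ e R Box y) - normalize (thetaOne Λ e R)) ≤
      Real.sqrt (2 * (π * (2 * Real.sqrt (finrank ℝ V) * Y + Y ^ 2) + banaConst ^ finrank ℝ V + 4⁻¹ ^ finrank ℝ V)) +
        2 * (2⁻¹ : ℝ) ^ finrank ℝ V := by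
  have h1 := l2_normalize_branchVec_sub_normalize_thetaTwo_le Λ e R hsvΛ hBox hy hδ
  have h2 : l2 (normalize (thetaTwo Λ e R) - normalize (thetaOne Λ e R)) ≤ 2 * (2⁻¹ : ℝ) ^ finrank ℝ V :=
    l2_normalize_thetaTwo_sub_normalize_thetaOne_le Λ e
  exact (l2_sub_le _ _ _).trans (add_le_add h1 h2)

end Branch

end Regev2009

end Literature.Algebra.EuclideanLattices

end
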